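import HarnessLib
import Summits.CriticalPhenomena.Ising3DConformalLimit.Theorems.HarmonicMomentsIsotropyTwoPointAsymptoticIsotropyPairPointwiseUniform
import Summits.CriticalPhenomena.Ising3DConformalLimit.Theorems.HarmonicMomentsIsotropyTwoPointAsymptoticIsotropyPairPointwiseScale
import Summits.CriticalPhenomena.Ising3DConformalLimit.Theorems.HarmonicMomentsIsotropyTwoPointAsymptoticIsotropyOfPairLimit
import Literature.Probability.LatticeModels.PointwiseScalingLimitEtaExists
import Summits.CriticalPhenomena.Ising3DConformalLimit.Theses.MirrorHoelderCompactness
import Summits.CriticalPhenomena.Ising3DConformalLimit.Theses.HarmonicMomentsIsotropy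

/-!
# Vague asymptotic isotropy of the critical `ℤ³` two-point function, XX:
# POINTWISE CONVERGENCE OF THE RESCALED TWO-POINT FUNCTION SUFFICES; item 6153 ⇒ item 6036
(route HarmonicMomentsIsotropy, support item stmt-CriticalPhenomena-6036 `TwoPointAsymptoticIsotropy`;
main file of the pointwise line)

**Theorem** (`twoPointAsymptoticIsotropy_of_pointwisePairLimit`). If for some renormalisation `ρ > 0`
on `(0,1]` the rescaled critical pair correlator `ρ(δ)²⟨σ_{[z₀/δ]}σ_{[z₁/δ]}⟩_{β_c}` of the
nearest-neighbour Ising model on `ℤ³` converges POINTWISE, as `δ → 0⁺`, at every pair `z₀ ≠ z₁`, to a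
limit that is non-zero at one such pair, then `⟨σ₀σ_x⟩_{β_c}` is asymptotically `O(3)`-invariant in the
vague sense (`TwoPointAsymptoticIsotropy`). This removes the local uniformity from the hypothesis of file
XIV (`twoPointAsymptoticIsotropy_of_nontrivialPairLimit`): positivity propagates
(`pair_pos_of_pos_pt`), scale covariance is automatic (file XV), the kernel is continuous off the origin
(files XVII–XIX: MMS monotonicity + homogeneity + sign symmetry), the convergence of the kernel
approximants is locally uniform (Pólya–Dini, file XIX), and it passes to PAIRS
(`pair_tendstoLocallyUniformlyOn_of_kernel_pt`) through the exact cell-offset identity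
`⌊z₁/δ⌋ - ⌊z₀/δ⌋ = ⌊(z₁ - z₀ + θ)/δ⌋`, `θ = z₀ - δ⌊z₀/δ⌋ ∈ [0,δ)³`, and uniform continuity of the kernel
on a compact thickening.

**Corollary** (`twoPointAsymptoticIsotropy_of_pointwiseLimitItem`): the crux `PointwiseLimit` of route
MirrorHoelderCompactness (item stmt-CriticalPhenomena-6153: pointwise full-filter convergence of all
rescaled critical correlators with the forced renormalisation `ρ₀(δ) = ⟨σ₀σ_{⌊1/δ⌋e₁}⟩^{-1/2}`) implies
item stmt-CriticalPhenomena-6036 — only its arity-`2` clause is used, and the limit is `1` at the pinning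
pair. Item 6153 is the uniqueness half of the shared existence crux `ExistsScaleCovariantLimit` (item
1981 ⟺ item 5955 ∧ item 6153, tree file `…CruxIffOrbitPrecompactPointwiseLimit`), so it is a strictly
weaker EXISTING upstream of the milestone than item 1981. The unconditional statement stays open
(Duminil-Copin, ICM 2022, §8.1).

References: H. Duminil-Copin, ICM 2022, §8.1, §8.4 [DuminilCopinICM2022]; A. Messager, S. Miracle-Solé,
J. Stat. Phys. 17 (1977) 245–262 [MessagerMiracleSoleJSP1977]. No definitions are introduced.
-/

noncomputable section

namespace Summit.CriticalPhenomena.Ising3DConformalLimit.HarmonicMomentsIsotropyTwoPoint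

open Literature.Probability.LatticeModels Filter Set Metric
open scoped Topology
open Summit.CriticalPhenomena.Ising3DConformalLimit.HyperoctahedralRPTwoPoint
open Summit.CriticalPhenomena.Ising3DConformalLimit.Theses.HarmonicMomentsIsotropy

variable {ρ : ℝ → ℝ} {S2 : (Fin 2 → EuclideanSpace ℝ (Fin 3)) → ℝ}

/-! ### The pair limit is the kernel of the difference -/

/-- A pointwise pair limit is a function of the difference: `S₂(z) = S₂(0, z₁ - z₀)` on non-coincident
pairs. [cite: FriedliVelenik2017, Thm. 3.17] -/
theorem pair_eq_kernel_sub_pt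
    (hlim : ∀ x ∈ NonCoincident 3 2, Tendsto (fun δ => rescaledCorrelator (criticalCorr 3) ρ 2 δ x)
      (𝓝[>] (0:ℝ)) (𝓝 (S2 x)))
    {z : Fin 2 → EuclideanSpace ℝ (Fin 3)} (hz : z ∈ NonCoincident 3 2) :
    S2 z = S2 ![0, z 1 - z 0] := by
  have hinj : Function.Injective z := hz
  have hne : z 0 ≠ z 1 := fun h => absurd (hinj h) (by decide)
  have hmem : (![0, z 1 - z 0] : Fin 2 → EuclideanSpace ℝ (Fin 3)) ∈ NonCoincident 3 2 :=
    zero_pair_mem_nonCoincident (sub_ne_zero.2 hne.symm)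
  have h := limit_translate_pt hlim (z 0) hmem
  have hcfg : (fun i => (![0, z 1 - z 0] : Fin 2 → EuclideanSpace ℝ (Fin 3)) i + z 0) = z := by
    funext i; fin_cases i <;> simp
  rw [hcfg] at h
  exact h

/-! ### From the kernel to pairs -/

/-- **Locally uniform convergence on non-coincident pairs from the kernel.** If the rescaled
two-point function converges locally uniformly on `ℝ³ ∖ {0}` to the kernel `K(y) = S₂(0,y)` of a
pointwise pair limit, `K` continuous off `0`, then the rescaled pair correlator converges to `S₂`
locally uniformly on `NonCoincident 3 2` (cell-offset identity `⌊z₁/δ⌋ - ⌊z₀/δ⌋ = ⌊(z₁ - z₀ + θ)/δ⌋`,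
`θ ∈ [0,δ)³`, and uniform continuity of `K` on a compact thickening). [folklore] -/
theorem pair_tendstoLocallyUniformlyOn_of_kernel_pt
    (hlim : ∀ x ∈ NonCoincident 3 2, Tendsto (fun δ => rescaledCorrelator (criticalCorr 3) ρ 2 δ x)
      (𝓝[>] (0:ℝ)) (𝓝 (S2 x)))
    (hKcont : ContinuousOn (fun y : EuclideanSpace ℝ (Fin 3) => S2 ![0, y]) {0}ᶜ)
    (hker : TendstoLocallyUniformlyOn (fun (δ : ℝ) (y : EuclideanSpace ℝ (Fin 3)) =>
        ρ δ ^ 2 * criticalTwoPoint 3 (latticeApprox δ y))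
      (fun y => S2 ![0, y]) (𝓝[>] (0:ℝ)) {0}ᶜ) :
    TendstoLocallyUniformlyOn (rescaledCorrelator (criticalCorr 3) ρ 2) S2 (𝓝[>] (0:ℝ))
      (NonCoincident 3 2) := by
  rw [tendstoLocallyUniformlyOn_iff_forall_isCompact (isOpen_nonCoincident 3 2)]
  intro C hC hCc
  rw [Metric.tendstoUniformlyOn_iff]
  intro ε hε
  have hε2 : 0 < ε / 2 := by positivity
  -- the compact set of differences and a compact thickening inside `{0}ᶜ`
  set w : (Fin 2 → EuclideanSpace ℝ (Fin 3)) → EuclideanSpace ℝ (Fin 3) := fun z => z 1 - z 0 with hw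
  have hwc : Continuous w := (continuous_apply 1).sub (continuous_apply 0)
  set W : Set (EuclideanSpace ℝ (Fin 3)) := w '' C with hW
  have hWc : IsCompact W := hCc.image hwc
  have hW0 : W ⊆ {0}ᶜ := by
    rintro _ ⟨z, hz, rfl⟩ h0
    have hinj : Function.Injective z := hC hz
    exact absurd (hinj (sub_eq_zero.1 h0)).symm (by decide)
  obtain ⟨η₀, hη₀, hsub⟩ := hWc.exists_cthickening_subset_open isOpen_compl_singleton hW0
  have hW'c : IsCompact (cthickening η₀ W) := hWc.cthickening
  -- uniform convergence of the kernel approximants on the thickening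
  have hunif := (tendstoLocallyUniformlyOn_iff_forall_isCompact isOpen_compl_singleton).1 hker _ hsub hW'c
  rw [Metric.tendstoUniformlyOn_iff] at hunif
  -- uniform continuity of `K` on the thickening
  have hUC := hW'c.uniformContinuousOn_of_continuous (hKcont.mono hsub)
  rw [Metric.uniformContinuousOn_iff] at hUC
  obtain ⟨β, hβ, hβK⟩ := hUC (ε / 2) hε2
  -- small meshes
  have hm : Set.Ioo (0:ℝ) (min η₀ β / 2) ∈ 𝓝[>] (0:ℝ) := Ioo_mem_nhdsGT (by positivity)
  filter_upwards [hunif (ε / 2) hε2, hm] with δ hδu hδ z hz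
  have hδ0 : 0 < δ := hδ.1
  have hδη : 2 * δ ≤ η₀ := by
    have := min_le_left η₀ β; linarith [hδ.2]
  have hδβ : 2 * δ < β := by
    have := min_le_right η₀ β; linarith [hδ.2]
  -- the offset `θ ∈ [0,δ)³` and the shifted difference `y`
  set θ : EuclideanSpace ℝ (Fin 3) := z 0 - δ • siteVec (latticeApprox δ (z 0)) with hθ
  have hθi : ∀ i, θ i = z 0 i - δ * ⌊z 0 i / δ⌋ := fun i => by
    simp [hθ, siteVec_apply, latticeApprox_apply]
  have hθbd : ∀ i, |θ i| ≤ δ := by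
    intro i
    rw [hθi]
    have h1 := Int.floor_le (z 0 i / δ)
    have h2 := Int.lt_floor_add_one (z 0 i / δ)
    rw [abs_le]
    constructor
    · have : δ * ⌊z 0 i / δ⌋ ≤ z 0 i := by
        calc δ * ⌊z 0 i / δ⌋ ≤ δ * (z 0 i / δ) := mul_le_mul_of_nonneg_left h1 hδ0.le
          _ = z 0 i := mul_div_cancel₀ _ hδ0.ne'
      linarith
    · have : z 0 i < δ * ⌊z 0 i / δ⌋ + δ := by
        calc z 0 i = δ * (z 0 i / δ) := (mul_div_cancel₀ _ hδ0.ne').symm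
          _ < δ * (⌊z 0 i / δ⌋ + 1) := mul_lt_mul_of_pos_left h2 hδ0
          _ = δ * ⌊z 0 i / δ⌋ + δ := by ring
      linarith
  set y : EuclideanSpace ℝ (Fin 3) := w z + θ with hy
  have hwzW : w z ∈ W := ⟨z, hz, rfl⟩
  have hdist : dist y (w z) ≤ 2 * δ := by
    rw [dist_eq_norm, show y - w z = θ by rw [hy]; abel]
    have h1 : ‖θ.ofLp‖ ≤ δ := (pi_norm_le_iff_of_nonneg hδ0.le).2 fun i => by
      rw [Real.norm_eq_abs]; exact hθbd i
    have h2 := norm_le_two_mul_norm_ofLp θ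
    linarith
  have hyW' : y ∈ cthickening η₀ W := mem_cthickening_of_dist_le y (w z) η₀ W hwzW (hdist.trans hδη)
  have hwW' : w z ∈ cthickening η₀ W := self_subset_cthickening _ hwzW
  -- the exact identity: the pair correlator at `z` is the kernel approximant at `y`
  have hcell : latticeApprox δ y = latticeApprox δ (z 1) - latticeApprox δ (z 0) := by
    funext i
    rw [Pi.sub_apply, latticeApprox_apply, latticeApprox_apply, latticeApprox_apply]
    have : y i = z 1 i - δ * ⌊z 0 i / δ⌋ := by
      rw [hy, PiLp.add_apply, hθi]
      simp only [hw, PiLp.sub_apply]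
      ring
    have hδne : δ ≠ 0 := hδ0.ne'
    rw [this, show (z 1 i - δ * ⌊z 0 i / δ⌋) / δ = z 1 i / δ - (⌊z 0 i / δ⌋ : ℤ) by
      field_simp, Int.floor_sub_intCast]
  have hresc : rescaledCorrelator (criticalCorr 3) ρ 2 δ z =
      ρ δ ^ 2 * criticalTwoPoint 3 (latticeApprox δ y) := by
    rw [rescaledCorrelator_apply, latticeApprox_comp_two, criticalCorr_two_pair, hcell]
  -- conclude
  rw [hresc, pair_eq_kernel_sub_pt hlim (hC hz)]
  have h1 := hδu y hyW'
  have h2 : dist (S2 ![0, w z]) (S2 ![0, y]) < ε / 2 :=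
    hβK (w z) hwW' y hyW' (by rw [dist_comm]; linarith)
  calc dist (S2 ![0, z 1 - z 0]) (ρ δ ^ 2 * criticalTwoPoint 3 (latticeApprox δ y))
      ≤ dist (S2 ![0, w z]) (S2 ![0, y]) + dist (S2 ![0, y]) (ρ δ ^ 2 * criticalTwoPoint 3 (latticeApprox δ y)) :=
        dist_triangle _ _ _
    _ < ε / 2 + ε / 2 := add_lt_add h2 h1
    _ = ε := by ring

/-! ### Positivity of a pointwise pair limit -/

/-- A pointwise pair limit is non-negative on non-coincident pairs (Griffiths' first inequality in the
limit). [folklore] -/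
theorem pair_nonneg_pt
    (hlim : ∀ x ∈ NonCoincident 3 2, Tendsto (fun δ => rescaledCorrelator (criticalCorr 3) ρ 2 δ x)
      (𝓝[>] (0:ℝ)) (𝓝 (S2 x))) :
    ∀ z ∈ NonCoincident 3 2, 0 ≤ S2 z := fun z hz =>
  ge_of_tendsto (hlim z hz) (Eventually.of_forall fun δ => by
    rw [rescaledCorrelator_apply, latticeApprox_comp_two, criticalCorr_two_pair]
    exact mul_nonneg (sq_nonneg _) (criticalTwoPoint_nonneg' _))

/-- **Positivity at one pair propagates to all pairs** (pointwise pair limit): inward by MMS in the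
limit (`two_le_two_of_mul_norm_lt_pt`), outward through the contracted limit `x ↦ S₂(μx)`
(`tendsto_comp_smul_pt`), a pointwise limit of the same lattice family and hence a constant multiple
of `S₂` (`exists_scale_pt`). [cite: MessagerMiracleSoleJSP1977, Theorem (monotonicity)] -/
theorem pair_pos_of_pos_pt (hρ : ∀ δ ∈ Set.Ioc (0:ℝ) 1, 0 < ρ δ)
    (hlim : ∀ x ∈ NonCoincident 3 2, Tendsto (fun δ => rescaledCorrelator (criticalCorr 3) ρ 2 δ x)
      (𝓝[>] (0:ℝ)) (𝓝 (S2 x)))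
    {x₀ : Fin 2 → EuclideanSpace ℝ (Fin 3)} (hx₀ : x₀ ∈ NonCoincident 3 2) (hpos : 0 < S2 x₀) :
    ∀ y ∈ NonCoincident 3 2, 0 < S2 y := by
  intro y hy
  have hinj₀ : Function.Injective x₀ := hx₀
  set r₀ : ℝ := ‖WithLp.ofLp (x₀ 0) - WithLp.ofLp (x₀ 1)‖ with hr₀
  set R : ℝ := ‖WithLp.ofLp (y 0) - WithLp.ofLp (y 1)‖ with hR
  have hr₀pos : 0 < r₀ := by
    rw [hr₀, norm_pos_iff, sub_ne_zero]
    intro h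
    exact absurd (hinj₀ ((WithLp.ofLp_injective 2) h)) (by decide)
  have hR0 : 0 ≤ R := norm_nonneg _
  have inward : ∀ x ∈ NonCoincident 3 2,
      (3:ℝ) * ‖WithLp.ofLp (x 0) - WithLp.ofLp (x 1)‖ < r₀ → 0 < S2 x :=
    fun x hx hfar => hpos.trans_le (two_le_two_of_mul_norm_lt_pt hlim hx hx₀ hfar)
  set μ : ℝ := r₀ / (3 * R + 3 * r₀ + r₀) with hμ
  have hden : 0 < (3:ℝ) * R + 3 * r₀ + r₀ := by positivity
  have hμ0 : 0 < μ := div_pos hr₀pos hden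
  have hμ1 : μ ≤ 1 := by
    rw [hμ, div_le_one hden]
    nlinarith
  have hμR : (3:ℝ) * (μ * R) < r₀ := by
    have : (3:ℝ) * (μ * R) = r₀ * (3 * R) / (3 * R + 3 * r₀ + r₀) := by rw [hμ]; ring
    rw [this, div_lt_iff₀ hden]
    nlinarith [mul_pos hr₀pos hr₀pos]
  have hμr : (3:ℝ) * (μ * r₀) < r₀ := by
    have : (3:ℝ) * (μ * r₀) = r₀ * (3 * r₀) / (3 * R + 3 * r₀ + r₀) := by rw [hμ]; ring
    rw [this, div_lt_iff₀ hden]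
    nlinarith [mul_nonneg hr₀pos.le hR0, mul_pos hr₀pos hr₀pos]
  have hlimμ := tendsto_comp_smul_pt hlim hμ0
  have hρμ : ∀ δ ∈ Set.Ioc (0:ℝ) 1, 0 < ρ (μ * δ) := fun δ hδ =>
    hρ _ ⟨mul_pos hμ0 hδ.1, mul_le_one₀ hμ1 hδ.1.le hδ.2⟩
  have hposμ : 0 < S2 (fun i => μ • x₀ i) := by
    refine inward _ (smul_mem_nonCoincident hμ0.ne' hx₀) ?_
    rw [norm_ofLp_smul_sub hμ0.le]
    exact hμr
  obtain ⟨c, hc, hscale, -⟩ := exists_scale_pt hρ hρμ hlim hlimμ hx₀ hpos hposμ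
  have hy' : 0 < S2 (fun i => μ • y i) := by
    refine inward _ (smul_mem_nonCoincident hμ0.ne' hy) ?_
    rw [norm_ofLp_smul_sub hμ0.le]
    exact hμR
  have heq : S2 (fun i => μ • y i) = c ^ 2 * S2 y := hscale y hy
  rw [heq] at hy'
  exact pos_of_mul_pos_right hy' (pow_pos hc 2).le

/-! ### The milestone from pointwise data -/

/-- **Pointwise convergence of the rescaled two-point function gives the milestone.** If for some
`ρ > 0` on `(0,1]` the rescaled critical pair correlator of the nearest-neighbour Ising model on `ℤ³`
converges pointwise at every non-coincident pair, to a limit non-zero at one pair, then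
`TwoPointAsymptoticIsotropy` (item stmt-CriticalPhenomena-6036) holds. [cite: DuminilCopinICM2022, §8.1] -/
theorem twoPointAsymptoticIsotropy_of_pointwisePairLimit
    (h : ∃ (ρ : ℝ → ℝ) (S2 : (Fin 2 → EuclideanSpace ℝ (Fin 3)) → ℝ),
      (∀ δ ∈ Set.Ioc (0:ℝ) 1, 0 < ρ δ) ∧
      (∀ z ∈ NonCoincident 3 2, Tendsto (fun δ => rescaledCorrelator (criticalCorr 3) ρ 2 δ z)
        (𝓝[>] (0:ℝ)) (𝓝 (S2 z))) ∧
      ∃ z ∈ NonCoincident 3 2, S2 z ≠ 0) :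
    TwoPointAsymptoticIsotropy := by
  obtain ⟨ρ, S2, hρ, hlim, z₀, hz₀, hz₀0⟩ := h
  have hz₀pos : 0 < S2 z₀ := lt_of_le_of_ne (pair_nonneg_pt hlim z₀ hz₀) (Ne.symm hz₀0)
  have hpos := pair_pos_of_pos_pt hρ hlim hz₀ hz₀pos
  obtain ⟨Δ, -, hcov, -⟩ := exists_rpow_scale_and_ratio_pt hρ hlim hpos
  have hhom : ∀ c : ℝ, 0 < c → ∀ y : EuclideanSpace ℝ (Fin 3), y ≠ 0 →
      S2 ![0, c • y] = c ^ (-(2 * Δ)) * S2 ![0, y] := by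
    intro c hc y hy
    have h := hcov c hc ![0, y] (zero_pair_mem_nonCoincident hy)
    rw [comp_zeroPair (smul_zero c) y] at h
    rw [h, show (-(2:ℝ) * Δ) = -(2 * Δ) by ring]
  have hKcont := kernel_continuousOn_pt hlim hhom
  have hker := kernel_tendstoLocallyUniformlyOn_pt hlim hhom
  have hTLUO := pair_tendstoLocallyUniformlyOn_of_kernel_pt hlim hKcont hker
  exact twoPointAsymptoticIsotropy_of_pairLimit ⟨ρ, S2, hρ, hTLUO, hpos⟩

/-- **Item stmt-CriticalPhenomena-6153 ⇒ item stmt-CriticalPhenomena-6036.** The crux `PointwiseLimit`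
of route MirrorHoelderCompactness (pointwise full-filter convergence of the rescaled critical correlators
on `ℤ³` with the forced renormalisation `ρ₀(δ) = ⟨σ₀σ_{⌊1/δ⌋e₁}⟩_{β_c}^{-1/2}`) implies the milestone
`TwoPointAsymptoticIsotropy`: its arity-`2` clause is a pointwise pair limit with `ρ₀ > 0`, equal to `1`
at the pinning pair `(0, e₁)` (the rescaled correlator is identically `1` there), so
`twoPointAsymptoticIsotropy_of_pointwisePairLimit` applies. [cite: DuminilCopinICM2022, §8.1] -/
theorem twoPointAsymptoticIsotropy_of_pointwiseLimitItem
    (hPL : Theses.MirrorHoelderCompactness.PointwiseLimit) : TwoPointAsymptoticIsotropy := by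
  classical
  have h2 := hPL 2
  choose! l hl using h2
  have hGpos : ∀ δ : ℝ, 0 < δ → 0 < criticalTwoPoint 3 (Pi.single 0 ⌊δ⁻¹⌋) := by
    intro δ hδ
    have : ⌊δ⁻¹⌋ = (((⌊δ⁻¹⌋).toNat : ℕ) : ℤ) :=
      (Int.toNat_of_nonneg (Int.floor_nonneg.2 (inv_nonneg.2 hδ.le))).symm
    rw [this]
    exact criticalTwoPoint_axis_pos _
  refine twoPointAsymptoticIsotropy_of_pointwisePairLimit ⟨_, l, fun δ hδ => ?_, hl, ?_⟩
  · exact Real.rpow_pos_of_pos (hGpos δ hδ.1) _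
  · have hmem : (![0, EuclideanSpace.single (0 : Fin 3) (1:ℝ)] : Fin 2 → EuclideanSpace ℝ (Fin 3)) ∈
        NonCoincident 3 2 := zero_unitVec_mem_nonCoincident one_ne_zero
    refine ⟨_, hmem, ?_⟩
    have hT := hl _ hmem
    -- the rescaled correlator at the pinning pair is eventually `1`
    have hev : ∀ᶠ δ in 𝓝[>] (0:ℝ),
        rescaledCorrelator (criticalCorr 3)
          (fun δ : ℝ => (criticalTwoPoint 3 (Pi.single 0 ⌊δ⁻¹⌋)) ^ (-(1/2:ℝ))) 2 δ
          ![0, EuclideanSpace.single (0 : Fin 3) (1:ℝ)] = 1 := by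
      filter_upwards [self_mem_nhdsWithin] with δ hδ
      have hδ0 : 0 < δ := hδ
      rw [rescaledCorrelator_zero_pair]
      have hlat : latticeApprox δ (EuclideanSpace.single (0 : Fin 3) (1:ℝ)) = Pi.single 0 ⌊δ⁻¹⌋ := by
        funext i
        rw [latticeApprox_apply]
        by_cases hi : i = 0
        · subst hi; simp [one_div]
        · simp [hi]
      rw [hlat]
      have hG := hGpos δ hδ0
      rw [← Real.rpow_natCast, ← Real.rpow_mul hG.le,
        show (-(1 / 2 : ℝ)) * ((2 : ℕ) : ℝ) = -1 by norm_num, Real.rpow_neg_one, inv_mul_cancel₀ hG.ne']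
    have h1 : l ![0, EuclideanSpace.single (0 : Fin 3) (1:ℝ)] = 1 :=
      tendsto_nhds_unique hT (tendsto_const_nhds.congr' (hev.mono fun δ h => h.symm))
    rw [h1]
    exact one_ne_zero

end Summit.CriticalPhenomena.Ising3DConformalLimit.HarmonicMomentsIsotropyTwoPoint

end
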